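import Summits.Ventures.PercRepro.C041ZoneOCubeHubSum
import Summits.Ventures.PercRepro.C041CSUnionPi
import Summits.Ventures.PercRepro.C041ZoneOCubeCS

/-!
# (CS) — AND (O-CUBE) — ON HUB CORES FROM THE ZONE (CS) OF THE INDEXED ZONES (p6, gen 28; C-041.md §16 (ii),
§17 (d): «exactly as in §14 (c), (CS) for every terminal-adjacent zone of a HUB core gives (CS) — and so (O-CUBE) —
for the whole»)

Setting of `C041ZoneOCubeHubSum` (the cube states of a tail-free hub core are the pairs of admissible zone-states
and an outside part, `cubeEquiv`) and `C041CSUnionPi`.  The COUNTS of the cube family — `cubeValidSet` (the valid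
cube states), `cubeGoodASet` / `cubeGoodBSet` (valid with `Good_a` / `Good_b`) — satisfy
`oCube = 3·#Good_a + 3·#Good_b − 2·#valid` (`oCube_eq_cube_counts`); the three predicates of a cube state are the
disjunctions over the zones of `ValidZone` / `G1Z` / `G2Z` of its zone-states (`valid_iff_restrict`,
`goodA_iff_restrict`, `goodB_iff_restrict`, the dictionary of `C041ZoneOCubeHub` read on the split), so each count
is `|OutT|` times the indicator sum of the disjunction over the product of the zone-states
(`card_cube_filter_eq`); per zone the indicator sums are the counts of the zone with forced edges
(`sum_ind_validZone_eq`, `sum_ind_G1Z_eq`, `sum_ind_G2Z_eq`), so the ZONE (CS) of a zone is (CS) of its component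
(`csInd_of_zoneCS`).  THE UNION LEMMA FOR (CS) over the indexed zones then gives:

* **`cube_cs_of_zoneCS_hub`** — on a tail-free hub core, the ZONE (CS) of every indexed zone gives
  `(#valid − #Good_a − #Good_b)₊² ≤ #Good_a · #Good_b` for the cube family;
* **`oCube_nonneg_of_zoneCS_hub`** — hence `0 ≤ oCube a b c O`: (O-CUBE) on hub cores from the ZONE (CS) of their
  zones, the (CS) form of gen 27's `oCube_nonneg_of_zoneOCube_hub`.
-/

namespace PercRepro

namespace MultiGraph

open Finset ZoneZ ZoneZ.ZoneData ZoneOCube CSCount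

variable {V E : Type*} {G : MultiGraph V E} {a b c : V}

/-! ## (CS) in the integer form and its scaling -/

/-- The `ℕ` form of (CS) from the integer positive-part form. -/
theorem cs_of_int_form {v x y : ℕ} (h : (max ((v : ℤ) - x - y) 0) ^ 2 ≤ x * y) : CS v x y := by
  unfold CS
  have e : max ((v : ℤ) - x - y) 0 = ((v - x - y : ℕ) : ℤ) := by omega
  rw [e] at h
  exact_mod_cast h

/-- The integer positive-part form of (CS) is homogeneous of degree two. -/
theorem int_form_mul {v x y N : ℤ} (hN : 0 ≤ N) (h : (max (v - x - y) 0) ^ 2 ≤ x * y) :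
    (max (N * v - N * x - N * y) 0) ^ 2 ≤ (N * x) * (N * y) := by
  have e : N * v - N * x - N * y = N * (v - x - y) := by ring
  have hm : N * max (v - x - y) 0 = max (N * (v - x - y)) (N * 0) := mul_max_of_nonneg _ _ hN
  rw [mul_zero] at hm
  rw [e, ← hm]
  calc (N * max (v - x - y) 0) ^ 2 = N ^ 2 * (max (v - x - y) 0) ^ 2 := by ring
    _ ≤ N ^ 2 * (x * y) := mul_le_mul_of_nonneg_left h (sq_nonneg N)
    _ = (N * x) * (N * y) := by ring

/-! ## The dictionary on the split of a cube state -/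

section Dict

variable [Fintype V] [Fintype E] [DecidableEq E] (hc : c ≠ a ∧ c ≠ b) (hne : a ≠ b) (hab : ∃ e, G.Joins e a b)
  {O : Config E}

include hc hab in
/-- A cube state of a tail-free colouring is valid iff some zone-state is `ValidZone`. -/
theorem valid_iff_restrict (hO : G.TailFree a b c O) {S : Config E} (hS : G.IsCubeState a b c O S) :
    ¬ G.RcInvalid a b c S ↔ ∃ Z : G.ZoneIdx a b c O, G.ValidZone a b c O Z.1 (G.restrictZone a b Z.1 S) := by
  rw [valid_iff_exists_zone hc hab hO hS]
  constructor
  · rintro ⟨Z, w, hw, e, hSe, hj⟩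
    have hZe : G.ZoneEdge a b Z.1 e := by
      rcases hj with hj | hj
      · exact zoneEdge_of_terminal (mem_of_kZone a b c hw) (Or.inl rfl) hj
      · exact zoneEdge_of_terminal (mem_of_kZone a b c hw) (Or.inr rfl) hj
    refine ⟨Z, w, (kZone_restrict_iff a b c Z.1 w).2 hw, e, ?_, hj⟩
    rw [extZone_restrictZone_agree Z.1 S e hZe]
    exact hSe
  · rintro ⟨Z, w, hw, e, hSe, hj⟩
    have hw' := (kZone_restrict_iff a b c Z.1 w).1 hw
    have hZe : G.ZoneEdge a b Z.1 e := by
      rcases hj with hj | hj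
      · exact zoneEdge_of_terminal (mem_of_kZone a b c hw') (Or.inl rfl) hj
      · exact zoneEdge_of_terminal (mem_of_kZone a b c hw') (Or.inr rfl) hj
    refine ⟨Z, w, hw', e, ?_, hj⟩
    rw [extZone_restrictZone_agree Z.1 S e hZe] at hSe
    exact hSe

omit [Fintype E] [DecidableEq E] in
include hc hne in
/-- A cube state of a tail-free hub core has `Good_a` iff some zone-state has `G1Z`. -/
theorem goodA_iff_restrict (hO : G.TailFree a b c O) (hhub : G.HubCore a b c O) {S : Config E}
    (hS : G.IsCubeState a b c O S) :
    G.WalkAvoiding S (G.cluster Sᶜ a) c b ↔ ∃ Z : G.ZoneIdx a b c O, G.G1Z a b c O Z.1 (G.restrictZone a b Z.1 S) := by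
  rw [goodA_iff_exists_zone hc hO hhub hS]
  constructor
  · rintro ⟨Z, w, hw, e, hj, hSe⟩
    refine ⟨Z, w, (reachZone_restrict_iff a b c hc hne hS Z.2 w).2 hw, e, hj, ?_⟩
    rw [extZone_restrictZone_agree Z.1 S e (zoneEdge_of_terminal (mem_of_reachZone a b c hw) (Or.inr rfl) hj)]
    exact hSe
  · rintro ⟨Z, w, hw, e, hj, hSe⟩
    refine ⟨Z, w, (reachZone_restrict_iff a b c hc hne hS Z.2 w).1 hw, e, hj, ?_⟩
    rw [extZone_restrictZone_agree Z.1 S e (zoneEdge_of_terminal (mem_of_reachZone a b c hw) (Or.inr rfl) hj)]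
      at hSe
    exact hSe

omit [Fintype E] [DecidableEq E] in
include hc hne in
/-- A cube state of a tail-free hub core has `Good_b` iff some zone-state has `G2Z`. -/
theorem goodB_iff_restrict (hO : G.TailFree a b c O) (hhub : G.HubCore a b c O) {S : Config E}
    (hS : G.IsCubeState a b c O S) :
    G.WalkAvoiding S (G.cluster Sᶜ b) c a ↔ ∃ Z : G.ZoneIdx a b c O, G.G2Z a b c O Z.1 (G.restrictZone a b Z.1 S) := by
  rw [goodB_iff_exists_zone hc hO hhub hS]
  constructor
  · rintro ⟨Z, w, hw, e, hj, hSe⟩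
    refine ⟨Z, w, (reachZoneB_restrict_iff hc hne hS Z.2 w).2 hw, e, hj, ?_⟩
    rw [extZone_restrictZone_agree Z.1 S e (zoneEdge_of_terminal (mem_of_reachZoneB hw) (Or.inl rfl) hj)]
    exact hSe
  · rintro ⟨Z, w, hw, e, hj, hSe⟩
    refine ⟨Z, w, (reachZoneB_restrict_iff hc hne hS Z.2 w).1 hw, e, hj, ?_⟩
    rw [extZone_restrictZone_agree Z.1 S e (zoneEdge_of_terminal (mem_of_reachZoneB hw) (Or.inl rfl) hj)]
      at hSe
    exact hSe

end Dict

/-! ## The counts of the cube family -/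

section Counts

variable [Fintype V] [Fintype E] [DecidableEq E] (a b c : V) (O : Config E)

open Classical in
/-- The valid cube states. -/
noncomputable def cubeValidSet (G : MultiGraph V E) : Finset (Config E) :=
  (G.cubeStateSet a b c O).filter fun S => ¬ G.RcInvalid a b c S

open Classical in
/-- The valid cube states with `Good_a`. -/
noncomputable def cubeGoodASet (G : MultiGraph V E) : Finset (Config E) :=
  (G.cubeStateSet a b c O).filter fun S => ¬ G.RcInvalid a b c S ∧ G.WalkAvoiding S (G.cluster Sᶜ a) c b

open Classical in
/-- The valid cube states with `Good_b`. -/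
noncomputable def cubeGoodBSet (G : MultiGraph V E) : Finset (Config E) :=
  (G.cubeStateSet a b c O).filter fun S => ¬ G.RcInvalid a b c S ∧ G.WalkAvoiding S (G.cluster Sᶜ b) c a

omit [Fintype V] in
open Classical in
/-- **The O-cube sum through the counts**: `oCube = 3·#Good_a + 3·#Good_b − 2·#valid`. -/
theorem oCube_eq_cube_counts :
    G.oCube a b c O = 3 * (#(G.cubeGoodASet a b c O) : ℤ) + 3 * #(G.cubeGoodBSet a b c O) -
      2 * #(G.cubeValidSet a b c O) := by
  rw [oCube_eq_sum_valid_cube]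
  have e0 : ((G.cubeStateSet a b c O).filter fun S => ¬ G.RcInvalid a b c S) = G.cubeValidSet a b c O := rfl
  have e1 : G.cubeGoodASet a b c O = (G.cubeValidSet a b c O).filter fun S => G.WalkAvoiding S (G.cluster Sᶜ a) c b := by
    ext S
    unfold cubeGoodASet cubeValidSet
    simp only [mem_filter, and_assoc]
  have e2 : G.cubeGoodBSet a b c O = (G.cubeValidSet a b c O).filter fun S => G.WalkAvoiding S (G.cluster Sᶜ b) c a := by
    ext S
    unfold cubeGoodBSet cubeValidSet
    simp only [mem_filter, and_assoc]
  have hw : ∀ S, G.gdWeight a b c S = 3 * (if G.WalkAvoiding S (G.cluster Sᶜ a) c b then 1 else 0) +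
      3 * (if G.WalkAvoiding S (G.cluster Sᶜ b) c a then 1 else 0) - 2 := by
    intro S
    unfold gdWeight
    split_ifs <;> norm_num
  rw [e0, e1, e2, Finset.sum_congr rfl fun S _ => hw S, Finset.sum_sub_distrib, Finset.sum_add_distrib,
    ← Finset.mul_sum, ← Finset.mul_sum, Finset.sum_boole, Finset.sum_boole, Finset.sum_const, nsmul_eq_mul]
  ring

omit [Fintype V] in
open Classical in
/-- A filtered count of cube states as an indicator sum (for any decidability instance of the predicate). -/
theorem natCast_card_cube_filter (p : Config E → Prop) (dp : DecidablePred p) :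
    (#(@Finset.filter _ p dp (G.cubeStateSet a b c O)) : ℤ) = ∑ S ∈ G.cubeStateSet a b c O, ZoneOCube.ind (p S) := by
  rw [Finset.natCast_card_filter]
  apply Finset.sum_congr rfl
  intro S _
  by_cases h : p S
  · rw [if_pos h, ind_of_true h]
  · rw [if_neg h, ind_of_false h]

end Counts

section Transport

variable [Fintype V] [Fintype E] [DecidableEq E] (hc : c ≠ a ∧ c ≠ b) (hne : a ≠ b) {O : Config E}

include hc hne in
open Classical in
/-- **A filtered count of cube states is `|OutT|` times an indicator sum over the product of the zone-states**, when
the predicate is read on the split of the state. -/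
theorem card_cube_filter_eq (p : Config E → Prop) (dp : DecidablePred p)
    (P : (∀ Z : G.ZoneIdx a b c O, G.AZ O Z) → Prop)
    (hp : ∀ S (hS : G.IsCubeState a b c O S),
      p S ↔ P (fun Z => ⟨G.restrictZone a b Z.1 S, admZone_restrict a b c hc hne hS Z.2⟩)) :
    (#(@Finset.filter _ p dp (G.cubeStateSet a b c O)) : ℤ) =
      (Fintype.card (G.OutT a b c O) : ℤ) * ∑ x : ∀ Z : G.ZoneIdx a b c O, G.AZ O Z, ZoneOCube.ind (P x) := by
  rw [natCast_card_cube_filter a b c O p dp]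
  have h2 : ∑ S ∈ G.cubeStateSet a b c O, ZoneOCube.ind (p S) =
      ∑ q : (∀ Z : G.ZoneIdx a b c O, G.AZ O Z) × G.OutT a b c O, ZoneOCube.ind (P q.1) := by
    refine Finset.sum_bij' (fun S hS => cubeEquiv hc hne ⟨S, by
        unfold cubeStateSet at hS
        rw [Finset.mem_filter] at hS
        exact hS.2⟩) (fun q _ => ((cubeEquiv hc hne).symm q).1) (fun _ _ => Finset.mem_univ _) ?_ ?_ ?_ ?_
    · intro q _
      unfold cubeStateSet
      rw [Finset.mem_filter]
      exact ⟨Finset.mem_univ _, ((cubeEquiv hc hne).symm q).2⟩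
    · intro S _
      rw [Equiv.symm_apply_apply]
    · intro q _
      change cubeEquiv hc hne ⟨((cubeEquiv hc hne).symm q).1, _⟩ = q
      exact Equiv.apply_symm_apply (cubeEquiv hc hne) q
    · intro S hS
      unfold cubeStateSet at hS
      rw [Finset.mem_filter] at hS
      exact ind_congr (hp S hS.2)
  rw [h2, Fintype.sum_prod_type]
  simp only [Finset.sum_const, Finset.card_univ, nsmul_eq_mul]
  rw [Finset.mul_sum]

include hc hne in
open Classical in
/-- The indicator sum of `ValidZone` over the admissible zone-states is the valid count of the zone with forced edges. -/
theorem sum_ind_validZone_eq (Z : G.ZoneIdx a b c O) :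
    ∑ x : G.AZ O Z, ZoneOCube.ind (G.ValidZone a b c O Z.1 x.1) =
      ((G.zoneFZ a b O Z.1).nValidF (G.zoneA a b c O Z.1) (zoneQ c Z.1) : ℤ) := by
  have hZnt : ∀ v ∈ Z.1, v ≠ a ∧ v ≠ b := fun v hv => ne_terminal_of_mem_idxZone hc Z.2 hv
  unfold FZone.nValidF
  rw [Finset.natCast_card_filter]
  refine Finset.sum_bij' (fun x _ => G.toStZ a b Z.1 x.1) (fun σ hσ => ⟨G.ofStZ a b Z.1 σ, ?_⟩) ?_ ?_ ?_ ?_ ?_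
  · unfold FZone.AsetF at hσ
    rw [Finset.mem_filter] at hσ
    rw [zone_admZone_iff hc O Z.2, toStZ_ofStZ hne hZnt σ]
    exact hσ.2
  · intro x _
    unfold FZone.AsetF
    rw [Finset.mem_filter]
    exact ⟨Finset.mem_univ _, (zone_admZone_iff hc O Z.2 x.1).1 x.2⟩
  · intro σ _
    exact Finset.mem_univ _
  · intro x _
    exact Subtype.ext (ofStZ_toStZ Z.1 x.1)
  · intro σ _
    exact toStZ_ofStZ hne hZnt σ
  · intro x _
    rw [ind_congr (zone_valid_iff hc O Z.2 x.1).symm]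
    by_cases h : (G.zoneFZ a b O Z.1).Valid (G.zoneA a b c O Z.1) (G.toStZ a b Z.1 x.1)
    · rw [ind_of_true h, if_pos h]
    · rw [ind_of_false h, if_neg h]

include hc hne in
open Classical in
/-- The indicator sum of `G1Z` over the admissible zone-states is the `G1` count of the zone with forced edges. -/
theorem sum_ind_G1Z_eq (Z : G.ZoneIdx a b c O) :
    ∑ x : G.AZ O Z, ZoneOCube.ind (G.G1Z a b c O Z.1 x.1) =
      ((G.zoneFZ a b O Z.1).nG1F (G.zoneA a b c O Z.1) (zoneQ c Z.1) : ℤ) := by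
  have hZnt : ∀ v ∈ Z.1, v ≠ a ∧ v ≠ b := fun v hv => ne_terminal_of_mem_idxZone hc Z.2 hv
  unfold FZone.nG1F
  rw [Finset.natCast_card_filter]
  refine Finset.sum_bij' (fun x _ => G.toStZ a b Z.1 x.1) (fun σ hσ => ⟨G.ofStZ a b Z.1 σ, ?_⟩) ?_ ?_ ?_ ?_ ?_
  · unfold FZone.AsetF at hσ
    rw [Finset.mem_filter] at hσ
    rw [zone_admZone_iff hc O Z.2, toStZ_ofStZ hne hZnt σ]
    exact hσ.2
  · intro x _
    unfold FZone.AsetF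
    rw [Finset.mem_filter]
    exact ⟨Finset.mem_univ _, (zone_admZone_iff hc O Z.2 x.1).1 x.2⟩
  · intro σ _
    exact Finset.mem_univ _
  · intro x _
    exact Subtype.ext (ofStZ_toStZ Z.1 x.1)
  · intro σ _
    exact toStZ_ofStZ hne hZnt σ
  · intro x _
    have hsub := blueSub_extZone_of_chords x.2.1
    have hadm : ¬ G.Conn (G.extZone a b O Z.1 x.1)ᶜ a b := (adm_extZone hc hne Z.2 x.2).2.2
    have e : G.G1Z a b c O Z.1 x.1 ↔ (G.zoneFZ a b O Z.1).G1 (G.zoneA a b c O Z.1) (G.toStZ a b Z.1 x.1) :=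
      (zone_G1_iff hc O Z.2 x.1 hsub hadm).symm
    rw [ind_congr e]
    by_cases h : (G.zoneFZ a b O Z.1).G1 (G.zoneA a b c O Z.1) (G.toStZ a b Z.1 x.1)
    · rw [ind_of_true h, if_pos h]
    · rw [ind_of_false h, if_neg h]

include hc hne in
open Classical in
/-- The indicator sum of `G2Z` over the admissible zone-states is the `G2` count of the zone with forced edges. -/
theorem sum_ind_G2Z_eq (Z : G.ZoneIdx a b c O) :
    ∑ x : G.AZ O Z, ZoneOCube.ind (G.G2Z a b c O Z.1 x.1) =
      ((G.zoneFZ a b O Z.1).nG2F (G.zoneA a b c O Z.1) (zoneQ c Z.1) : ℤ) := by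
  have hZnt : ∀ v ∈ Z.1, v ≠ a ∧ v ≠ b := fun v hv => ne_terminal_of_mem_idxZone hc Z.2 hv
  unfold FZone.nG2F
  rw [Finset.natCast_card_filter]
  refine Finset.sum_bij' (fun x _ => G.toStZ a b Z.1 x.1) (fun σ hσ => ⟨G.ofStZ a b Z.1 σ, ?_⟩) ?_ ?_ ?_ ?_ ?_
  · unfold FZone.AsetF at hσ
    rw [Finset.mem_filter] at hσ
    rw [zone_admZone_iff hc O Z.2, toStZ_ofStZ hne hZnt σ]
    exact hσ.2
  · intro x _
    unfold FZone.AsetF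
    rw [Finset.mem_filter]
    exact ⟨Finset.mem_univ _, (zone_admZone_iff hc O Z.2 x.1).1 x.2⟩
  · intro σ _
    exact Finset.mem_univ _
  · intro x _
    exact Subtype.ext (ofStZ_toStZ Z.1 x.1)
  · intro σ _
    exact toStZ_ofStZ hne hZnt σ
  · intro x _
    have hsub := blueSub_extZone_of_chords x.2.1
    have hadm : ¬ G.Conn (G.extZone a b O Z.1 x.1)ᶜ a b := (adm_extZone hc hne Z.2 x.2).2.2
    have e : G.G2Z a b c O Z.1 x.1 ↔ (G.zoneFZ a b O Z.1).G2 (G.zoneA a b c O Z.1) (G.toStZ a b Z.1 x.1) :=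
      (zone_G2_iff hc O Z.2 x.1 hsub hadm).symm
    rw [ind_congr e]
    by_cases h : (G.zoneFZ a b O Z.1).G2 (G.zoneA a b c O Z.1) (G.toStZ a b Z.1 x.1)
    · rw [ind_of_true h, if_pos h]
    · rw [ind_of_false h, if_neg h]

include hc hne in
open Classical in
/-- **The ZONE (CS) of an indexed zone is (CS) of its component of admissible zone-states.** -/
theorem csInd_of_zoneCS (Z : G.ZoneIdx a b c O)
    (h : (G.zoneFZ a b O Z.1).ZoneCSConjF (G.zoneA a b c O Z.1) (zoneQ c Z.1)) :
    CSInd (fun x : G.AZ O Z => G.ValidZone a b c O Z.1 x.1) (fun x => G.G1Z a b c O Z.1 x.1)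
      (fun x => G.G2Z a b c O Z.1 x.1) := by
  unfold CSInd
  rw [sum_ind_validZone_eq hc hne Z, sum_ind_G1Z_eq hc hne Z, sum_ind_G2Z_eq hc hne Z]
  unfold FZone.ZoneCSConjF CS at h
  have e : max (((G.zoneFZ a b O Z.1).nValidF (G.zoneA a b c O Z.1) (zoneQ c Z.1) : ℤ) -
      ((G.zoneFZ a b O Z.1).nG1F (G.zoneA a b c O Z.1) (zoneQ c Z.1) : ℤ) -
      ((G.zoneFZ a b O Z.1).nG2F (G.zoneA a b c O Z.1) (zoneQ c Z.1) : ℤ)) 0 =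
      (((G.zoneFZ a b O Z.1).nValidF (G.zoneA a b c O Z.1) (zoneQ c Z.1) -
        (G.zoneFZ a b O Z.1).nG1F (G.zoneA a b c O Z.1) (zoneQ c Z.1) -
        (G.zoneFZ a b O Z.1).nG2F (G.zoneA a b c O Z.1) (zoneQ c Z.1) : ℕ) : ℤ) := by omega
  rw [e]
  exact_mod_cast h

include hc hne in
open Classical in
/-- **(CS) ON HUB CORES FROM THE ZONE (CS)**: for a tail-free hub core `O`, if every indexed zone satisfies the ZONE
(CS) conjecture (on its zone with forced edges, with its anchors and the protected anchor `{c} ∩ Z`), then the cube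
family satisfies `(#valid − #Good_a − #Good_b)₊² ≤ #Good_a · #Good_b`. -/
theorem cube_cs_of_zoneCS_hub (hab : ∃ e, G.Joins e a b) (hO : G.TailFree a b c O) (hhub : G.HubCore a b c O)
    (hzone : ∀ Z : G.ZoneIdx a b c O, (G.zoneFZ a b O Z.1).ZoneCSConjF (G.zoneA a b c O Z.1) (zoneQ c Z.1)) :
    CS #(G.cubeValidSet a b c O) #(G.cubeGoodASet a b c O) #(G.cubeGoodBSet a b c O) := by
  classical
  apply cs_of_int_form
  have hV : (#(G.cubeValidSet a b c O) : ℤ) = (Fintype.card (G.OutT a b c O) : ℤ) *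
      ∑ x : ∀ Z : G.ZoneIdx a b c O, G.AZ O Z, ZoneOCube.ind (∃ Z, G.ValidZone a b c O Z.1 (x Z).1) := by
    unfold cubeValidSet
    exact card_cube_filter_eq hc hne _ _ _ (fun S hS => valid_iff_restrict hc hab hO hS)
  have hA : (#(G.cubeGoodASet a b c O) : ℤ) = (Fintype.card (G.OutT a b c O) : ℤ) *
      ∑ x : ∀ Z : G.ZoneIdx a b c O, G.AZ O Z, ZoneOCube.ind (∃ Z, G.G1Z a b c O Z.1 (x Z).1) := by
    unfold cubeGoodASet
    refine card_cube_filter_eq hc hne _ _ _ (fun S hS => ?_)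
    rw [goodA_iff_restrict hc hne hO hhub hS]
    constructor
    · exact fun h => h.2
    · rintro ⟨Z, hZ⟩
      refine ⟨?_, Z, hZ⟩
      rw [valid_iff_restrict hc hab hO hS]
      exact ⟨Z, validZone_of_G1Z hZ⟩
  have hB : (#(G.cubeGoodBSet a b c O) : ℤ) = (Fintype.card (G.OutT a b c O) : ℤ) *
      ∑ x : ∀ Z : G.ZoneIdx a b c O, G.AZ O Z, ZoneOCube.ind (∃ Z, G.G2Z a b c O Z.1 (x Z).1) := by
    unfold cubeGoodBSet
    refine card_cube_filter_eq hc hne _ _ _ (fun S hS => ?_)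
    rw [goodB_iff_restrict hc hne hO hhub hS]
    constructor
    · exact fun h => h.2
    · rintro ⟨Z, hZ⟩
      refine ⟨?_, Z, hZ⟩
      rw [valid_iff_restrict hc hab hO hS]
      exact ⟨Z, validZone_of_G2Z hZ⟩
  rw [hV, hA, hB]
  apply int_form_mul (Nat.cast_nonneg _)
  exact union_lemma_cs_fintype (S := fun Z : G.ZoneIdx a b c O => G.AZ O Z)
    (fun Z x => G.ValidZone a b c O Z.1 x.1) (fun Z x => G.G1Z a b c O Z.1 x.1) (fun Z x => G.G2Z a b c O Z.1 x.1)
    (fun _ _ h => validZone_of_G1Z h) (fun _ _ h => validZone_of_G2Z h) fun Z => csInd_of_zoneCS hc hne Z (hzone Z)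

include hc hne in
open Classical in
/-- **(O-CUBE) ON HUB CORES FROM THE ZONE (CS)** — the (CS) form of `oCube_nonneg_of_zoneOCube_hub`. -/
theorem oCube_nonneg_of_zoneCS_hub (hab : ∃ e, G.Joins e a b) (hO : G.TailFree a b c O) (hhub : G.HubCore a b c O)
    (hzone : ∀ Z : G.ZoneIdx a b c O, (G.zoneFZ a b O Z.1).ZoneCSConjF (G.zoneA a b c O Z.1) (zoneQ c Z.1)) :
    0 ≤ G.oCube a b c O := by
  rw [oCube_eq_cube_counts]
  have := two_mul_le_of_cs (cube_cs_of_zoneCS_hub hc hne hab hO hhub hzone)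
  omega

end Transport

end MultiGraph

end PercRepro
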